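import Mathlib
import Literature.Barriers.ValiantsHypothesis.AlgebraicNaturalProofs
import Literature.Computability.AlgebraicComplexity.ArithCircuitProofs
import Summits.ValiantsHypothesis.ValiantsHypothesis.Theorems.BarrierLeverPartitionMinorsHitByVPProductStates

/-!
# Route BarrierLever — item `PartitionMinorsHitByVP` (stmt-ValiantsHypothesis-19717):
# CORANK REPAIR — a base polynomial whose layout minor has corank `d` is repaired by `d` monomials

Helper file (`--supports stmt-ValiantsHypothesis-19717`; cell valiant-natproofs, rung V4, 𝒟-side,
prover seat valiant-natproofs-prover gen 6). Definition-free. Closes NO item.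

Item 19717 asks, for every layout `(u, w)` (injective `u, w : Fin r → Finset (Fin h)`), for SOME
`f ∈ SmallCircuits ℂ (h+h) b` whose partition-matrix minor `M(f) = (coeff_{x^{u i} y^{w j}} f)_{i,j}`
is nonsingular; the witness may depend on the layout. This file turns the requirement
"nonsingular" into the weaker requirement "corank polynomial in `h`" for an arbitrary base:

* `exists_rank_lt_rank_add_single` (linear algebra over a field): if a square matrix `A` has
  `rank A < n` then for some position `(i, j)` the matrix `A + E_{ij}` has larger rank — take a
  column `j` lying in the span of the other columns and a unit vector `e_i` outside the column span;
  the new column span contains the old one and `e_i`.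
* `matrix_add_xyMonomial`: adding the monomial `x^{u i} y^{w j}` to `g` adds `E_{ij}` to `M(g)`
  (injectivity of the layout and of the partition exponent).
* **`exists_repair`** (induction on `d`): if `rank M(g) + d ≥ r` then some `f = g + (≤ d monomials)`
  has `det M(f) ≠ 0`, `deg f ≤ max (deg g) 2h` and `L(f) ≤ L(g) + d (2h + 2)`.
* **`hit_of_corank_le`**: base `g ∈ SmallCircuits ℂ (h+h) b` with corank `≤ (h+h)^c` on the layout
  ⇒ the layout is hit inside `SmallCircuits ℂ (h+h) (max b (c+2) + 1)` (`h ≥ 1`).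

So item 19717 follows from: «some polynomial-size family (sums of product states, MPOs, the
determinantal pencil `det(1 + diag(x,y) K)`, …) has corank `≤ poly(h)` on EVERY layout» — a rank
bound instead of a non-vanishing statement. The cell's near-principal range (`…ProductStateSums.
partitionMinor_hit_of_nearPrincipal`, seat val-np-p3) is the special case `g = ∏_a (1 + x_a y_a)`,
whose minor is a partial permutation matrix of corank = number of unmatched rows.

WHAT THIS IS NOT: no corank bound is proved here for any family on the middle band
`(h+h)^c < r < 2^h − (h+h)^c` (that is the open content of item 19717); nothing on crux 14610.

References: N. Nisan, STOC 1991 (partition matrix); [ForbesShpilkaVolk2018] §8; [Burgisser2000]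
§2.1 (size bookkeeping: variables and constants free, one gate per `+`/`×`).
-/

set_option linter.dupNamespace false

namespace Summit.ValiantsHypothesis.ValiantsHypothesis.Theorems.BarrierLever.CorankRepair

open Finset MvPolynomial Module
open Literature.Barriers.ValiantsHypothesis Literature.Computability.AlgebraicComplexity
open Summit.ValiantsHypothesis.ValiantsHypothesis.Theorems.BarrierLever.ProductStateSums
  (castAdd_ne_natAdd partitionExpo_apply_castAdd partitionExpo_apply_natAdd)

noncomputable section

/-! ## 1. Linear algebra: one new entry raises a deficient rank -/

section LinearAlgebra

variable {m K : Type*} [Fintype m] [DecidableEq m] [Field K]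

/-- **Rank bump.** If a square matrix over a field has `rank A < n`, then for some position
`(i, j)` the matrix `A + E_{ij}` has strictly larger rank: choose a column `j` in the span of the
other columns and a unit vector `e_i` outside the column span. -/
theorem exists_rank_lt_rank_add_single (A : Matrix m m K) (hA : A.rank < Fintype.card m) :
    ∃ i j : m, A.rank < (A + Matrix.single i j 1).rank := by
  classical
  -- (a) some column lies in the span of the other columns
  have hdep : ¬ LinearIndependent K A.col := by
    intro hli
    have h1 : A.rank = Fintype.card m :=
      A.rank_of_isUnit (Matrix.linearIndependent_cols_iff_isUnit.mp hli)
    omega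
  rw [linearIndependent_iff_notMem_span] at hdep
  push Not at hdep
  obtain ⟨j, hj⟩ := hdep
  -- (b) some unit vector lies outside the column span
  have hspan : Submodule.span K (Set.range A.col) ≠ ⊤ := by
    intro htop
    have h1 := A.rank_eq_finrank_span_cols
    rw [htop, finrank_top, Module.finrank_fintype_fun_eq_card] at h1
    omega
  obtain ⟨i, hi⟩ : ∃ i, (Pi.single i 1 : m → K) ∉ Submodule.span K (Set.range A.col) := by
    by_contra hall
    push Not at hall
    apply hspan
    rw [eq_top_iff, ← (Pi.basisFun K m).span_eq, Submodule.span_le]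
    rintro _ ⟨i', rfl⟩
    rw [Pi.basisFun_apply]
    exact hall i'
  refine ⟨i, j, ?_⟩
  -- (c) the columns of the bumped matrix
  set B := A + Matrix.single i j 1 with hB
  have hcol_ne : ∀ j', j' ≠ j → B.col j' = A.col j' := by
    intro j' hj'
    ext i'
    rw [Matrix.col_apply, Matrix.col_apply, hB, Matrix.add_apply, Matrix.single_apply_of_ne,
      add_zero]
    exact fun hh => hj' hh.2.symm
  have hcol_j : B.col j = A.col j + Pi.single i 1 := by
    ext i'
    rw [Matrix.col_apply, Pi.add_apply, Matrix.col_apply, hB, Matrix.add_apply,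
      Matrix.single_apply, Pi.single_apply]
    by_cases hii : i = i'
    · subst hii
      simp
    · rw [if_neg (fun hh => hii hh.1), if_neg (fun hh => hii hh.symm)]
  -- (d) old column span ≤ new column span, strictly
  have hle : Submodule.span K (Set.range A.col) ≤ Submodule.span K (Set.range B.col) := by
    rw [Submodule.span_le]
    rintro _ ⟨j', rfl⟩
    by_cases hj' : j' = j
    · subst hj'
      refine Submodule.span_mono ?_ hj
      rintro _ ⟨j'', hj'', rfl⟩
      have hne : j'' ≠ j' := fun hh => hj''.2 (by simp [hh])
      exact ⟨j'', hcol_ne j'' hne⟩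
    · exact Submodule.subset_span ⟨j', hcol_ne j' hj'⟩
  rw [A.rank_eq_finrank_span_cols, B.rank_eq_finrank_span_cols]
  apply Submodule.finrank_lt_finrank_of_lt
  refine lt_of_le_of_ne hle fun heq => hi ?_
  rw [heq]
  have hsingle : (Pi.single i 1 : m → K) = B.col j - A.col j := by
    rw [hcol_j]
    abel
  rw [hsingle]
  exact Submodule.sub_mem _ (Submodule.subset_span ⟨j, rfl⟩)
    (hle (Submodule.subset_span ⟨j, rfl⟩))

/-- Full rank ⇒ nonzero determinant. -/
theorem det_ne_zero_of_rank_eq (A : Matrix m m K) (hA : A.rank = Fintype.card m) : A.det ≠ 0 := by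
  have hli : LinearIndependent K A.col := by
    rw [linearIndependent_iff_card_eq_finrank_span, Set.finrank, ← A.rank_eq_finrank_span_cols, hA]
  have hU : IsUnit A := Matrix.linearIndependent_cols_iff_isUnit.mp hli
  exact ((Matrix.isUnit_iff_isUnit_det A).mp hU).ne_zero

end LinearAlgebra

/-! ## 2. The correction monomial `x^U y^W` -/

variable {h : ℕ}

/-- The exponent vector of `x^U y^W` determines `(U, W)`. -/
theorem partitionExpo_eq_iff (U W U' W' : Finset (Fin h)) :
    ((∑ a ∈ U, Finsupp.single (Fin.castAdd h a) 1 + ∑ c ∈ W, Finsupp.single (Fin.natAdd h c) 1 :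
        Fin (h + h) →₀ ℕ) =
      ∑ a ∈ U', Finsupp.single (Fin.castAdd h a) 1 + ∑ c ∈ W', Finsupp.single (Fin.natAdd h c) 1)
    ↔ U = U' ∧ W = W' := by
  refine ⟨fun hUW => ⟨?_, ?_⟩, ?_⟩
  · ext a
    have h1 := congrArg (fun v : Fin (h + h) →₀ ℕ => (v : Fin (h + h) → ℕ) (Fin.castAdd h a)) hUW
    simp only [partitionExpo_apply_castAdd] at h1
    by_cases ha : a ∈ U <;> by_cases ha' : a ∈ U' <;> simp_all
  · ext c
    have h2 := congrArg (fun v : Fin (h + h) →₀ ℕ => (v : Fin (h + h) → ℕ) (Fin.natAdd h c)) hUW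
    simp only [partitionExpo_apply_natAdd] at h2
    by_cases hc : c ∈ W <;> by_cases hc' : c ∈ W' <;> simp_all
  · rintro ⟨rfl, rfl⟩
    rfl

/-- `(∏_{a∈U} x_a) (∏_{c∈W} y_c)` is the monomial with the partition exponent of `(U, W)`. -/
theorem prod_X_mul_prod_X_eq_monomial (U W : Finset (Fin h)) :
    ((∏ a ∈ U, X (Fin.castAdd h a)) * ∏ c ∈ W, X (Fin.natAdd h c) :
        MvPolynomial (Fin (h + h)) ℂ) =
      monomial (∑ a ∈ U, Finsupp.single (Fin.castAdd h a) 1 +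
        ∑ c ∈ W, Finsupp.single (Fin.natAdd h c) 1) 1 := by
  have hx : (∏ a ∈ U, X (Fin.castAdd h a) : MvPolynomial (Fin (h + h)) ℂ) =
      monomial (∑ a ∈ U, Finsupp.single (Fin.castAdd h a) 1) 1 := by
    rw [monomial_sum_one]
    rfl
  have hy : (∏ c ∈ W, X (Fin.natAdd h c) : MvPolynomial (Fin (h + h)) ℂ) =
      monomial (∑ c ∈ W, Finsupp.single (Fin.natAdd h c) 1) 1 := by
    rw [monomial_sum_one]
    rfl
  rw [hx, hy, monomial_mul, mul_one]

/-- Coefficient of `x^U y^W` in the monomial `x^{U'} y^{W'}`: `[U' = U ∧ W' = W]`. -/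
theorem coeff_xyMonomial (U W U' W' : Finset (Fin h)) :
    coeff (∑ a ∈ U, Finsupp.single (Fin.castAdd h a) 1 + ∑ c ∈ W, Finsupp.single (Fin.natAdd h c) 1)
      ((∏ a ∈ U', X (Fin.castAdd h a)) * ∏ c ∈ W', X (Fin.natAdd h c) :
        MvPolynomial (Fin (h + h)) ℂ) = if U' = U ∧ W' = W then 1 else 0 := by
  classical
  rw [prod_X_mul_prod_X_eq_monomial, coeff_monomial]
  simp_rw [partitionExpo_eq_iff]

/-- A correction monomial `x^U y^W` has degree `≤ 2h`. -/
theorem totalDegree_xyMonomial_le (U W : Finset (Fin h)) :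
    ((∏ a ∈ U, X (Fin.castAdd h a)) * ∏ c ∈ W, X (Fin.natAdd h c) :
      MvPolynomial (Fin (h + h)) ℂ).totalDegree ≤ h + h := by
  refine (totalDegree_mul _ _).trans (add_le_add ?_ ?_)
  · refine (totalDegree_finsetProd _ _).trans ?_
    calc ∑ a ∈ U, (X (Fin.castAdd h a) : MvPolynomial (Fin (h + h)) ℂ).totalDegree
        = ∑ _a ∈ U, 1 := Finset.sum_congr rfl fun a _ => totalDegree_X _
      _ = U.card := by simp
      _ ≤ h := by simpa using Finset.card_le_univ U
  · refine (totalDegree_finsetProd _ _).trans ?_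
    calc ∑ c ∈ W, (X (Fin.natAdd h c) : MvPolynomial (Fin (h + h)) ℂ).totalDegree
        = ∑ _c ∈ W, 1 := Finset.sum_congr rfl fun c _ => totalDegree_X _
      _ = W.card := by simp
      _ ≤ h := by simpa using Finset.card_le_univ W

/-- A correction monomial `x^U y^W` has size `≤ 2h + 1` (variables are free). -/
theorem complexity_xyMonomial_le (U W : Finset (Fin h)) :
    complexity ((∏ a ∈ U, X (Fin.castAdd h a)) * ∏ c ∈ W, X (Fin.natAdd h c) :
      MvPolynomial (Fin (h + h)) ℂ) ≤ h + h + 1 := by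
  have hx : ∑ a ∈ U, complexity (X (Fin.castAdd h a) : MvPolynomial (Fin (h + h)) ℂ) = 0 :=
    Finset.sum_eq_zero fun a _ => complexity_X_holds _
  have hy : ∑ c ∈ W, complexity (X (Fin.natAdd h c) : MvPolynomial (Fin (h + h)) ℂ) = 0 :=
    Finset.sum_eq_zero fun c _ => complexity_X_holds _
  calc complexity ((∏ a ∈ U, X (Fin.castAdd h a)) * ∏ c ∈ W, X (Fin.natAdd h c) :
          MvPolynomial (Fin (h + h)) ℂ)
      ≤ complexity (∏ a ∈ U, X (Fin.castAdd h a) : MvPolynomial (Fin (h + h)) ℂ) +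
          complexity (∏ c ∈ W, X (Fin.natAdd h c) : MvPolynomial (Fin (h + h)) ℂ) + 1 :=
        complexity_mul_le_holds _ _
    _ ≤ h + h + 1 := by
        gcongr
        · calc complexity (∏ a ∈ U, X (Fin.castAdd h a) : MvPolynomial (Fin (h + h)) ℂ)
              ≤ ∑ a ∈ U, complexity (X (Fin.castAdd h a) : MvPolynomial (Fin (h + h)) ℂ) +
                  U.card := complexity_finset_prod_le _ _
            _ ≤ h := by rw [hx, zero_add]; simpa using Finset.card_le_univ U
        · calc complexity (∏ c ∈ W, X (Fin.natAdd h c) : MvPolynomial (Fin (h + h)) ℂ)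
              ≤ ∑ c ∈ W, complexity (X (Fin.natAdd h c) : MvPolynomial (Fin (h + h)) ℂ) +
                  W.card := complexity_finset_prod_le _ _
            _ ≤ h := by rw [hy, zero_add]; simpa using Finset.card_le_univ W

/-! ## 3. Repair by induction on the corank -/

variable {r : ℕ}

/-- Adding the monomial `x^{u i} y^{w j}` to `g` adds the elementary matrix `E_{ij}` to the layout
minor (the layout is injective, the partition exponent is injective). -/
theorem matrix_add_xyMonomial (u w : Fin r → Finset (Fin h)) (hu : Function.Injective u)
    (hw : Function.Injective w) (g : MvPolynomial (Fin (h + h)) ℂ) (i j : Fin r) :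
    (Matrix.of fun i' j' : Fin r => coeff
        (∑ a ∈ u i', Finsupp.single (Fin.castAdd h a) 1 +
          ∑ c ∈ w j', Finsupp.single (Fin.natAdd h c) 1)
        (g + (∏ a ∈ u i, X (Fin.castAdd h a)) * ∏ c ∈ w j, X (Fin.natAdd h c))) =
      (Matrix.of fun i' j' : Fin r => coeff
        (∑ a ∈ u i', Finsupp.single (Fin.castAdd h a) 1 +
          ∑ c ∈ w j', Finsupp.single (Fin.natAdd h c) 1) g) + Matrix.single i j 1 := by
  ext i' j'
  rw [Matrix.add_apply, Matrix.of_apply, Matrix.of_apply, coeff_add, coeff_xyMonomial,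
    Matrix.single_apply]
  congr 1
  refine if_congr ⟨fun hh => ⟨hu hh.1, hw hh.2⟩, ?_⟩ rfl rfl
  rintro ⟨rfl, rfl⟩
  exact ⟨rfl, rfl⟩

/-- **Repair by induction on the corank.** If the layout minor of `g` has rank `≥ r − d`, then
adding at most `d` correction monomials gives a polynomial `f` with a NONSINGULAR layout minor,
`deg f ≤ max (deg g) 2h` and `L(f) ≤ L(g) + d (2h + 2)`. -/
theorem exists_repair (u w : Fin r → Finset (Fin h)) (hu : Function.Injective u)
    (hw : Function.Injective w) :
    ∀ (d : ℕ) (g : MvPolynomial (Fin (h + h)) ℂ),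
      r ≤ (Matrix.of fun i j : Fin r => coeff
          (∑ a ∈ u i, Finsupp.single (Fin.castAdd h a) 1 +
            ∑ c ∈ w j, Finsupp.single (Fin.natAdd h c) 1) g).rank + d →
      ∃ f : MvPolynomial (Fin (h + h)) ℂ,
        f.totalDegree ≤ max g.totalDegree (h + h) ∧
        complexity f ≤ complexity g + d * (h + h + 2) ∧
        (Matrix.of fun i j : Fin r => coeff
          (∑ a ∈ u i, Finsupp.single (Fin.castAdd h a) 1 +
            ∑ c ∈ w j, Finsupp.single (Fin.natAdd h c) 1) f).det ≠ 0 := by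
  classical
  intro d
  induction d with
  | zero =>
    intro g hg
    refine ⟨g, le_max_left _ _, by simp, det_ne_zero_of_rank_eq _ ?_⟩
    rw [Fintype.card_fin]
    exact le_antisymm (Matrix.rank_le_width _) (by simpa using hg)
  | succ d ih =>
    intro g hg
    set A := (Matrix.of fun i j : Fin r => coeff
      (∑ a ∈ u i, Finsupp.single (Fin.castAdd h a) 1 +
        ∑ c ∈ w j, Finsupp.single (Fin.natAdd h c) 1) g) with hA
    by_cases hfull : A.rank = r
    · refine ⟨g, le_max_left _ _, by simp, det_ne_zero_of_rank_eq _ ?_⟩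
      rw [Fintype.card_fin]
      exact hfull
    · have hlt : A.rank < Fintype.card (Fin r) := by
        rw [Fintype.card_fin]
        exact lt_of_le_of_ne (Matrix.rank_le_width A) hfull
      obtain ⟨i, j, hij⟩ := exists_rank_lt_rank_add_single A hlt
      set g' := g + (∏ a ∈ u i, X (Fin.castAdd h a)) * ∏ c ∈ w j, X (Fin.natAdd h c) with hg'
      have hM : (Matrix.of fun i' j' : Fin r => coeff
          (∑ a ∈ u i', Finsupp.single (Fin.castAdd h a) 1 +
            ∑ c ∈ w j', Finsupp.single (Fin.natAdd h c) 1) g') = A + Matrix.single i j 1 :=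
        matrix_add_xyMonomial u w hu hw g i j
      obtain ⟨f, hfdeg, hfsize, hfdet⟩ := ih g' (by rw [hM]; omega)
      refine ⟨f, hfdeg.trans ?_, hfsize.trans ?_, hfdet⟩
      · -- degree
        refine max_le ((totalDegree_add _ _).trans (max_le (le_max_left _ _) ?_)) (le_max_right _ _)
        exact (totalDegree_xyMonomial_le _ _).trans (le_max_right _ _)
      · -- size
        calc complexity g' + d * (h + h + 2)
            ≤ (complexity g + complexity ((∏ a ∈ u i, X (Fin.castAdd h a)) *
                ∏ c ∈ w j, X (Fin.natAdd h c) : MvPolynomial (Fin (h + h)) ℂ) + 1) +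
                d * (h + h + 2) := by
              gcongr
              exact complexity_add_le_holds _ _
          _ ≤ (complexity g + (h + h + 1) + 1) + d * (h + h + 2) := by
              gcongr
              exact complexity_xyMonomial_le _ _
          _ = complexity g + (d + 1) * (h + h + 2) := by ring

/-! ## 4. Packaging: a cheap base of polynomial corank suffices -/

/-- **Corank repair for item 19717.** If a base polynomial `g ∈ SmallCircuits ℂ (h+h) b` has layout
minor of rank `≥ r − (h+h)^c` (corank polynomial in `h`), then the layout is hit inside
`SmallCircuits ℂ (h+h) (max b (c+2) + 1)` (`h ≥ 1`). -/
theorem hit_of_corank_le (b c : ℕ) (hh : 1 ≤ h) (u w : Fin r → Finset (Fin h))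
    (hu : Function.Injective u) (hw : Function.Injective w) (g : MvPolynomial (Fin (h + h)) ℂ)
    (hg : g ∈ SmallCircuits ℂ (h + h) b)
    (hrank : r ≤ (Matrix.of fun i j : Fin r => MvPolynomial.coeff
        (∑ a ∈ u i, Finsupp.single (Fin.castAdd h a) 1 +
          ∑ c ∈ w j, Finsupp.single (Fin.natAdd h c) 1) g).rank + (h + h) ^ c) :
    ∃ f ∈ SmallCircuits ℂ (h + h) (max b (c + 2) + 1),
      (Matrix.of fun i j : Fin r => MvPolynomial.coeff
        (∑ a ∈ u i, Finsupp.single (Fin.castAdd h a) 1 +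
          ∑ c ∈ w j, Finsupp.single (Fin.natAdd h c) 1) f).det ≠ 0 := by
  obtain ⟨f, hfdeg, hfsize, hfdet⟩ := exists_repair u w hu hw ((h + h) ^ c) g hrank
  refine ⟨f, ⟨hfdeg.trans (max_le hg.1 le_rfl), hfsize.trans ?_⟩, hfdet⟩
  have h2 : h + h + 2 ≤ (h + h) ^ 2 := by nlinarith
  have hb : (h + h) ^ b ≤ (h + h) ^ max b (c + 2) :=
    Nat.pow_le_pow_right (by omega) (le_max_left _ _)
  have hc : (h + h) ^ (c + 2) ≤ (h + h) ^ max b (c + 2) :=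
    Nat.pow_le_pow_right (by omega) (le_max_right _ _)
  calc complexity g + (h + h) ^ c * (h + h + 2)
      ≤ (h + h) ^ b + (h + h) ^ c * (h + h) ^ 2 := by gcongr; exact hg.2
    _ = (h + h) ^ b + (h + h) ^ (c + 2) := by ring
    _ ≤ (h + h) ^ max b (c + 2) + (h + h) ^ max b (c + 2) := add_le_add hb hc
    _ = 2 * (h + h) ^ max b (c + 2) := by ring
    _ ≤ (h + h) * (h + h) ^ max b (c + 2) := Nat.mul_le_mul_right _ (by omega)
    _ = (h + h) ^ (max b (c + 2) + 1) := by ring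

/-- Sanity instance (the trivial base `g = 0`, corank `r`): every layout with `r ≤ (h+h)^c` is hit
inside `SmallCircuits ℂ (h+h) (c+3)` (the cell's `…partitionMinor_hit_of_card_le` has the sharper
exponent `c + 2`). -/
theorem hit_of_card_le (c : ℕ) (hh : 1 ≤ h) (u w : Fin r → Finset (Fin h))
    (hu : Function.Injective u) (hw : Function.Injective w) (hr : r ≤ (h + h) ^ c) :
    ∃ f ∈ SmallCircuits ℂ (h + h) (c + 3),
      (Matrix.of fun i j : Fin r => MvPolynomial.coeff
        (∑ a ∈ u i, Finsupp.single (Fin.castAdd h a) 1 +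
          ∑ c ∈ w j, Finsupp.single (Fin.natAdd h c) 1) f).det ≠ 0 := by
  have h0 : (0 : MvPolynomial (Fin (h + h)) ℂ) ∈ SmallCircuits ℂ (h + h) 0 := by
    refine ⟨by simp, ?_⟩
    rw [← C_0, complexity_C_holds]
    exact Nat.zero_le _
  have := hit_of_corank_le 0 c hh u w hu hw 0 h0 (hr.trans (Nat.le_add_left _ _))
  simpa [Nat.max_eq_right (Nat.zero_le _)] using this

end

end Summit.ValiantsHypothesis.ValiantsHypothesis.Theorems.BarrierLever.CorankRepair
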